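import Summits.CriticalPhenomena.SAWScalingLimit.Theorems.ForwardDriving.Negative.SAWReversalUpgradeForwardDrivingLoadBearing
import Summits.CriticalPhenomena.SAWScalingLimit.Theorems.SAWReversalUpgradeAttachmentExists

/-!
# Load-bearing hypotheses of crux `SAWReversalUpgrade.ForwardDriving` (stmt-CriticalPhenomena-18003), II:
# the orientation clauses of the standard attachment

Refuter (cdisprove, cycle 1), hypothesis mutation, continued from
`…ForwardDriving.Negative.SAWReversalUpgradeForwardDrivingLoadBearing`.

`forwardDriving_false_without_orientation`: drop the two conjuncts `(att δ γ).source = a` and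
`(att δ γ).target = b` of the standard-attachment hypothesis (keep injectivity, interior and BOTH range
clauses) — FALSE.  Witness: unit disc, any endpoint approximation and chordal uniformizer `φ`, and the
TIME-REVERSED standard attachment `(att δ γ).reverse` (a standard `att` exists: `attachmentExists_proof`,
stmt-CriticalPhenomena-18009): same trace, still injective, interior in `D`, but running from `b` to `a`.
A Loewner-described class through `φ` ends at `D.pt 1 = b` (`IsCompactifiedImage … (D.pt 1)`), the
reversed class ends at `a ≠ b`, so it is never `IsLoewnerDescribable φ`, its `drivingFunction` is the junk
`0`, and the Dirac law at the zero path is not that of `√(8/3)B|[0,1]`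
(`not_tendstoLaw_const_sleDriving`).  Informal content: given the range `S₁` (a simple arc from `a` to `b`)
and injectivity, the orientation is the ONLY remaining datum of the class `CurveClass.mk (att δ γ)`; one of
the two clauses is redundant (an injective parametrisation of the arc starting at `a` ends at `b`), both
together are load-bearing.
-/

open scoped NNReal Topology BoundedContinuousFunction unitInterval
open Filter Set MeasureTheory ProbabilityTheory
open Literature.Probability.RandomPlanarGeometry Literature.Probability Literature.Probability.LatticeModels

namespace Summit.CriticalPhenomena.SAWScalingLimit.Theorems.ForwardDriving.Negative

/-- **The orientation clauses `source = a`, `target = b` of the standard attachment are load-bearing in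
`ForwardDriving`**: with both dropped, the time-reversed standard attachment satisfies every remaining
clause and has junk driving function `0` (its class ends at `a`, a described class ends at `b`), whose
Dirac law is not Wiener.  Unit disc witness. [folklore] -/
theorem forwardDriving_false_without_orientation :
    ¬ (∀ (D : Literature.Probability.RandomPlanarGeometry.DobrushinDomain) (a b : ℝ → Literature.Probability.LatticeModels.Site 2), Literature.Probability.RandomPlanarGeometry.SAW.IsEndpointApprox D a b → ∀ (φ : Literature.Probability.RandomPlanarGeometry.ConformalEquiv UpperHalfPlane.upperHalfPlaneSet D.carrier), D.IsChordalUniformizing φ → ∀ (att : ((δ : ℝ) → Literature.Probability.RandomPlanarGeometry.SAW.DomainSAW (D).carrier δ (a δ) (b δ) → Literature.Probability.RandomPlanarGeometry.Curve ℂ)), (∀ᶠ δ in (nhdsWithin (0:ℝ) (Set.Ioi 0)), ∀ γ : Literature.Probability.RandomPlanarGeometry.SAW.DomainSAW (D).carrier δ (a δ) (b δ), (let a₁ := (D).pt 0; let b₁ := (D).pt 1; let P₁ : C(unitInterval, ℂ) := (γ.walk.toCurve (Literature.Probability.LatticeModels.meshPoint δ)); let R₁ := fun u : ℝ => P₁ (Set.projIcc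 (0:ℝ) 1 zero_le_one u); let φ₁ := (φ).boundaryExtension; let ψ₁ := Function.invFunOn φ₁ {z : ℂ | 0 ≤ z.im}; let e₁ : ℝ := min δ (1/2); let A₁ := fun z : ℂ => (‖z‖ : ℂ) * Complex.exp (Complex.I * ((e₁ : ℂ) + (1 - 2 * (e₁ : ℂ) / (Real.pi : ℂ)) * (Complex.arg z : ℂ))); let Z₁ := fun u : ℝ => @ite ℂ (R₁ u = b₁) (Classical.propDecidable _) b₁ (φ₁ (A₁ (ψ₁ (R₁ u)))); let i₁ := sSup ({(0:ℝ)} ∪ {u | u ∈ Set.Icc (0:ℝ) 1 ∧ R₁ u = a₁}); let j₁ := sInf ({(1:ℝ)} ∪ {u | u ∈ Set.Icc (0:ℝ) 1 ∧ R₁ u = b₁}); let M₁ := Z₁ '' Set.Icc i₁ j₁; let p₁ := A₁ (ψ₁ (R₁ i₁)); let q₁ := A₁ (ψ₁ (R₁ j₁)); let s₁ := sInf {s | s ∈ Set.Ioc (0:ℝ) 1 ∧ φ₁ ((s : ℂ) * p₁) ∈ M₁}; let r₁ := sSup ({(1:ℝ)} ∪ {r | 1 ≤ r ∧ R₁ j₁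 ≠ b₁ ∧ φ₁ ((r : ℂ) * q₁) ∈ M₁}); let u₁ := sInf {u | u ∈ Set.Icc i₁ j₁ ∧ Z₁ u = φ₁ ((s₁ : ℂ) * p₁)}; let v₁ := sSup ({u | u ∈ Set.Icc i₁ j₁ ∧ R₁ j₁ = b₁ ∧ u = j₁} ∪ {u | u ∈ Set.Icc i₁ j₁ ∧ R₁ j₁ ≠ b₁ ∧ Z₁ u = φ₁ ((r₁ : ℂ) * q₁)}); let S₁ := ((({a₁, b₁} ∪ ((fun s : ℝ => φ₁ ((s : ℂ) * p₁)) '' Set.Ioc 0 s₁)) ∪ (Z₁ '' Set.Icc u₁ v₁)) ∪ ((fun r : ℝ => φ₁ ((r : ℂ) * q₁)) '' {r | r₁ ≤ r ∧ R₁ j₁ ≠ b₁})); Function.Injective (att δ γ) ∧ (∀ t : unitInterval, (att δ γ) t = a₁ ∨ (att δ γ) t = b₁ ∨ (att δ γ) t ∈ (D).carrier) ∧ (u₁ < v₁ → Set.range (att δ γ) = S₁) ∧ (¬ u₁ < v₁ → Set.range (att δ γ) = {a₁, b₁} ∪ ((fun y : ℝ => φ₁ (Complex.I * (y : ℂ)))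 '' Set.Ioi 0)))) → ∀ T : NNReal, Literature.Probability.RandomPlanarGeometry.TendstoLaw (fun δ (γ : Literature.Probability.RandomPlanarGeometry.SAW.DomainSAW D.carrier δ (a δ) (b δ)) => ((⟨Literature.Probability.RandomPlanarGeometry.drivingFunction (φ) (Literature.Probability.RandomPlanarGeometry.CurveClass.mk (att δ γ)), Literature.Probability.RandomPlanarGeometry.continuous_drivingFunction (φ) (Literature.Probability.RandomPlanarGeometry.CurveClass.mk (att δ γ))⟩ : C(NNReal, ℝ)).restrict (Set.Icc (0:NNReal) T))) (fun δ => Literature.Probability.RandomPlanarGeometry.SAW.law (D).carrier δ (a δ) (b δ)) (fun ω : NNReal → ℝ => ((⟨Literature.Probability.RandomPlanarGeometry.sleDriving ((8:NNReal)/3) ω, Literature.Probability.RandomPlanarGeometry.continuous_sleDriving ((8:NNReal)/3) ω⟩ : C(NNReal, ℝ)).restrict (Set.Icc (0:NNReal) T))) Literature.Probability.Process.preWienerMeasure) := by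
  intro H
  set D := DobrushinDomain.unitDisc with hD
  have hpt0 : D.pt 0 = 1 := by
    rw [hD]; simp [MarkedDomain.pt, DobrushinDomain.unitDisc, JordanDomain.unitDisc, circleMap]
  have hpt1 : D.pt 1 = -1 := by
    have h : D.pt 1 = circleMap 0 1 (2 * Real.pi * (1 / 2)) := by rw [hD]; rfl
    rw [h, circleMap]
    have : ((2 * Real.pi * (1 / 2) : ℝ) : ℂ) * Complex.I = Real.pi * Complex.I := by push_cast; ring
    rw [this, Complex.exp_pi_mul_I]; simp
  obtain ⟨a, b, hab⟩ := SAW.exists_isEndpointApprox D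
  obtain ⟨φ, hφ⟩ := MarkedDomain.exists_isChordalUniformizing_holds D
  obtain ⟨att, hatt⟩ :=
    Summit.CriticalPhenomena.SAWScalingLimit.Theorems.attachmentExists_proof D φ hφ a b hab
  have hrange : ∀ δ γ, Set.range ((att δ γ).reverse) = Set.range (att δ γ) := fun δ γ =>
    (att δ γ).range_reverse
  -- the reversed attachment satisfies every remaining clause
  have H' := H D a b hab φ hφ (fun δ γ => (att δ γ).reverse) (by
    filter_upwards [hatt] with δ hδ γ
    obtain ⟨hinj, -, -, hint, hr1, hr2⟩ := hδ γ
    refine ⟨?_, ?_, ?_, ?_⟩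
    · intro s t h
      simp only [Curve.reverse_apply] at h
      exact unitInterval.symm_bijective.injective (hinj h)
    · intro t
      exact hint (σ t)
    · intro h
      rw [hrange]
      exact hr1 h
    · intro h
      rw [hrange]
      exact hr2 h) 1
  -- the reversed attached curves are never Loewner-describable through `φ` (they end at `a ≠ b`)
  have hnd : ∀ᶠ δ in 𝓝[>] (0:ℝ), ∀ γ : SAW.DomainSAW D.carrier δ (a δ) (b δ),
      ¬ IsLoewnerDescribable φ (CurveClass.mk (att δ γ).reverse) := by
    filter_upwards [hatt] with δ hδ γ hdesc
    obtain ⟨W, -, γ', -, c', hc', hci⟩ := hdesc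
    obtain ⟨-, hsrc, -, -, -, -⟩ := hδ γ
    have h1 : (CurveClass.mk (att δ γ).reverse).target = D.pt 0 := by
      rw [CurveClass.target_mk]
      change (att δ γ).reverse 1 = _
      rw [Curve.reverse_apply, unitInterval.symm_one]
      exact hsrc
    have h2 : (CurveClass.mk (att δ γ).reverse).target = D.pt 1 := by
      rw [hc', CurveClass.target_mk]
      exact hci.2
    have h3 : D.pt 0 = D.pt 1 := h1.symm.trans h2
    rw [hpt0, hpt1] at h3
    norm_num at h3
  -- hence the observed path is the zero path, eventually for every walk: Dirac, not Wiener
  refine not_tendstoLaw_const_sleDriving (fun δ => SAW.law D.carrier δ (a δ) (b δ))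
    ((0 : C(ℝ≥0, ℝ)).restrict (Set.Icc (0:ℝ≥0) 1)) (κ := (8:ℝ≥0)/3) (by norm_num) ?_
  intro f
  refine (H' f).congr' ?_
  filter_upwards [hnd] with δ hδ
  refine integral_congr_ae (ae_of_all _ fun γ => ?_)
  simp only
  congr 1
  ext t
  simp [ContinuousMap.restrict_apply, drivingFunction_of_not (hδ γ)]

end Summit.CriticalPhenomena.SAWScalingLimit.Theorems.ForwardDriving.Negative
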